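import Mathlib.Analysis.InnerProductSpace.Basic
import HarnessLib

/-!
# Robustness of a designed contact (registered stub `stub_contactPerturbation`, refutation line
# `ignition-cascade-refutation`, crux `InfluenceLocality`, stmt-AtomisticToContinuum-13916)

Pure Euclidean geometry in a real inner product space `E`. A mover–target pair has relative position `q`
and relative velocity `u`; its free relative motion is `p(t) = q + t u` and a contact is `‖p(t)‖ = ε`.
Nominal data `(q₀, u₀)` reach the contact sphere at time `t₀ ≥ 0` with impact vector `n₀ = q₀ + t₀ u₀`,
incoming at an angle of cosine `≥ κ` (`⟪n₀, u₀⟫ ≤ -κ ε ‖u₀‖`). The actual data deviate from the nominal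
free motion by at most `D` in position over the window `[0, t₀ + s]`, `s = 2D/(κ‖u₀‖)`, and by at most
`D‖u₀‖/ε` in velocity, with `D < κ² ε / 4`. Then

* `contactPerturbation_noEarly` — no contact strictly before `t₀ - s` (distance `> ε`);
* `contactPerturbation_overlap` — overlap (distance `< ε`) at `t₀ + s` when `0 < D`
  (`contactPerturbation_overlap_le`: distance `≤ ε` when only `0 ≤ D`);
* `contactPerturbation_normal` — any contact in `[t₀ - s, t₀ + s]` has impact vector within `(1 + 2/κ) D`
  of `n₀` (for contact times `< 0`, which the window allows when `t₀ < s`, this needs the backward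
  estimate `contactPerturbation_backward_aux`);
* `contactPerturbation_incoming` — and is incoming, `⟪p(t), u⟫ < 0`;
* `stub_contactPerturbation` — the registered conjunction (with `0 < D`: for `D = 0` the second conjunct
  reads `‖n₀‖ < ε`, contradicting `‖n₀‖ = ε`); `contactPerturbation_nonneg` — the same for `0 ≤ D` with
  the non-strict second conjunct.

The computations all rest on `‖n₀ + τ u₀‖² = ε² + 2τ⟪n₀, u₀⟫ + τ²‖u₀‖²`.
-/

namespace Summit.AtomisticToContinuum.HydrodynamicLimit.Theorems.InfluenceLocality.Negative

open scoped InnerProductSpace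

noncomputable section

variable {E : Type*} [NormedAddCommGroup E] [InnerProductSpace ℝ E]

/-! ## Algebraic identities -/

/-- Expansion `‖n + τ • v‖² = ‖n‖² + 2τ⟪n, v⟫ + τ²‖v‖²` in a real inner product space. -/
theorem contactPerturbation_norm_add_smul_sq (n v : E) (τ : ℝ) :
    ‖n + τ • v‖ ^ 2 = ‖n‖ ^ 2 + 2 * τ * ⟪n, v⟫_ℝ + τ ^ 2 * ‖v‖ ^ 2 := by
  rw [norm_add_sq_real, real_inner_smul_right, norm_smul, Real.norm_eq_abs, mul_pow, sq_abs]
  ring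

/-- The nominal free motion around the nominal contact time `t₀`:
`‖q₀ + t u₀‖² = ‖n₀‖² + 2 (t - t₀) ⟪n₀, u₀⟫ + (t - t₀)² ‖u₀‖²` with `n₀ = q₀ + t₀ u₀`. -/
theorem contactPerturbation_nominal_sq (q₀ u₀ : E) (t t₀ : ℝ) :
    ‖q₀ + t • u₀‖ ^ 2 = ‖q₀ + t₀ • u₀‖ ^ 2 + 2 * (t - t₀) * ⟪q₀ + t₀ • u₀, u₀⟫_ℝ
      + (t - t₀) ^ 2 * ‖u₀‖ ^ 2 := by
  have h : q₀ + t • u₀ = (q₀ + t₀ • u₀) + (t - t₀) • u₀ := by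
    rw [sub_smul]; abel
  rw [h]
  exact contactPerturbation_norm_add_smul_sq _ _ _

/-- Perturbed motion = nominal motion + deviation: `q + t u = (q₀ + t u₀) + ((q - q₀) + t (u - u₀))`. -/
theorem contactPerturbation_perturbed_eq (q₀ u₀ q u : E) (t : ℝ) :
    q + t • u = (q₀ + t • u₀) + ((q - q₀) + t • (u - u₀)) := by
  rw [smul_sub]; abel

/-- Perturbed impact vector minus the nominal one = deviation + nominal drift:
`(q + t u) - (q₀ + t₀ u₀) = ((q - q₀) + t (u - u₀)) + (t - t₀) u₀`. -/
theorem contactPerturbation_sub_nominal_eq (q₀ u₀ q u : E) (t t₀ : ℝ) :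
    (q + t • u) - (q₀ + t₀ • u₀) = ((q - q₀) + t • (u - u₀)) + (t - t₀) • u₀ := by
  rw [smul_sub, sub_smul]; abel

/-- The perturbed distance is at least the nominal one minus the deviation. -/
theorem contactPerturbation_nominal_sub_dev_le (q₀ u₀ q u : E) (t : ℝ) :
    ‖q₀ + t • u₀‖ - ‖(q - q₀) + t • (u - u₀)‖ ≤ ‖q + t • u‖ := by
  have h : q₀ + t • u₀ = (q + t • u) - ((q - q₀) + t • (u - u₀)) := by
    rw [contactPerturbation_perturbed_eq q₀ u₀ q u t]; abel
  have := norm_sub_le (q + t • u) ((q - q₀) + t • (u - u₀))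
  rw [← h] at this
  linarith

/-- The perturbed distance is at most the nominal one plus the deviation. -/
theorem contactPerturbation_le_nominal_add_dev (q₀ u₀ q u : E) (t : ℝ) :
    ‖q + t • u‖ ≤ ‖q₀ + t • u₀‖ + ‖(q - q₀) + t • (u - u₀)‖ := by
  rw [contactPerturbation_perturbed_eq q₀ u₀ q u t]
  exact norm_add_le _ _

/-! ## No early contact -/

/-- No early contact: if the deviation at time `t` is at most `D` and `t < t₀ - 2D/(κ‖u₀‖)`, then the
perturbed pair is at distance `> ε` at time `t`. Indeed for `t ≤ t₀`,
`‖q₀ + t u₀‖² ≥ ε² + 2 (t₀ - t) κ ε ‖u₀‖ > ε² + 4 D ε ≥ (ε + D)²`. -/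
theorem contactPerturbation_noEarly {q₀ u₀ q u : E} {ε κ t₀ D t : ℝ} (hε : 0 < ε) (hκ : 0 < κ)
    (hκ1 : κ ≤ 1) (hu₀ : u₀ ≠ 0)
    (hcontact : ‖q₀ + t₀ • u₀‖ = ε) (hin : ⟪q₀ + t₀ • u₀, u₀⟫_ℝ ≤ -(κ * ε * ‖u₀‖))
    (hD : 0 ≤ D) (hDsmall : D < κ ^ 2 * ε / 4)
    (hdev : ‖(q - q₀) + t • (u - u₀)‖ ≤ D) (ht : t < t₀ - 2 * D / (κ * ‖u₀‖)) :
    ε < ‖q + t • u‖ := by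
  have hL0 : 0 < ‖u₀‖ := norm_pos_iff.mpr hu₀
  have hκL : 0 < κ * ‖u₀‖ := mul_pos hκ hL0
  have hsκL : 2 * D / (κ * ‖u₀‖) * (κ * ‖u₀‖) = 2 * D := div_mul_cancel₀ _ hκL.ne'
  have hs0 : 0 ≤ 2 * D / (κ * ‖u₀‖) := div_nonneg (by linarith) hκL.le
  have hτ : t - t₀ ≤ 0 := by linarith
  have hκ2 : κ ^ 2 ≤ 1 := pow_le_one₀ hκ.le hκ1
  have hD2ε : 0 ≤ 2 * ε - D := by nlinarith
  have h1 : (t - t₀) * -(κ * ε * ‖u₀‖) ≤ (t - t₀) * ⟪q₀ + t₀ • u₀, u₀⟫_ℝ :=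
    mul_le_mul_of_nonpos_left hin hτ
  have h2 : 2 * D * ε < (t₀ - t) * (κ * ε * ‖u₀‖) := by
    have hlt : 2 * D / (κ * ‖u₀‖) < t₀ - t := by linarith
    have := mul_lt_mul_of_pos_right hlt (mul_pos hκL hε)
    calc 2 * D * ε = 2 * D / (κ * ‖u₀‖) * (κ * ‖u₀‖) * ε := by rw [hsκL]
      _ = 2 * D / (κ * ‖u₀‖) * (κ * ‖u₀‖ * ε) := by ring
      _ < (t₀ - t) * (κ * ‖u₀‖ * ε) := this
      _ = (t₀ - t) * (κ * ε * ‖u₀‖) := by ring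
  have hsq : (ε + D) ^ 2 < ‖q₀ + t • u₀‖ ^ 2 := by
    rw [contactPerturbation_nominal_sq q₀ u₀ t t₀, hcontact]
    nlinarith [sq_nonneg ((t - t₀) * ‖u₀‖), mul_nonneg hD hD2ε]
  have hlt : ε + D < ‖q₀ + t • u₀‖ := lt_of_pow_lt_pow_left₀ 2 (norm_nonneg _) hsq
  linarith [contactPerturbation_nominal_sub_dev_le q₀ u₀ q u t]

/-! ## Overlap at the end of the window -/

/-- The nominal distance at the end of the window: with `s = 2D/(κ‖u₀‖)`,
`‖q₀ + (t₀ + s) u₀‖² ≤ ε² - 4 D ε + (2D/κ)²` and `(2D/κ)² ≤ ε D` (from `D ≤ κ²ε/4`). -/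
theorem contactPerturbation_nominal_end_sq {q₀ u₀ : E} {ε κ t₀ D : ℝ} (hκ : 0 < κ) (hu₀ : u₀ ≠ 0)
    (hcontact : ‖q₀ + t₀ • u₀‖ = ε) (hin : ⟪q₀ + t₀ • u₀, u₀⟫_ℝ ≤ -(κ * ε * ‖u₀‖))
    (hD : 0 ≤ D) (hDsmall : D < κ ^ 2 * ε / 4) :
    ‖q₀ + (t₀ + 2 * D / (κ * ‖u₀‖)) • u₀‖ ^ 2 ≤ ε ^ 2 - 3 * D * ε := by
  have hL0 : 0 < ‖u₀‖ := norm_pos_iff.mpr hu₀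
  have hκL : 0 < κ * ‖u₀‖ := mul_pos hκ hL0
  set s := 2 * D / (κ * ‖u₀‖) with hs_def
  have hsκL : s * (κ * ‖u₀‖) = 2 * D := div_mul_cancel₀ _ hκL.ne'
  have hs0 : 0 ≤ s := div_nonneg (by linarith) hκL.le
  have hm : (s * ‖u₀‖) * κ = 2 * D := by rw [← hsκL]; ring
  -- `(s‖u₀‖)² ≤ ε D`
  have hm2 : (s * ‖u₀‖) ^ 2 ≤ ε * D := by
    have h4 : 4 * D * D ≤ κ ^ 2 * ε * D := by nlinarith
    have hκ2pos : 0 < κ ^ 2 := by positivity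
    have : κ ^ 2 * (s * ‖u₀‖) ^ 2 ≤ κ ^ 2 * (ε * D) := by
      calc κ ^ 2 * (s * ‖u₀‖) ^ 2 = ((s * ‖u₀‖) * κ) ^ 2 := by ring
        _ = 4 * D * D := by rw [hm]; ring
        _ ≤ κ ^ 2 * ε * D := h4
        _ = κ ^ 2 * (ε * D) := by ring
    exact le_of_mul_le_mul_left this hκ2pos
  have h1 : s * ⟪q₀ + t₀ • u₀, u₀⟫_ℝ ≤ s * -(κ * ε * ‖u₀‖) := mul_le_mul_of_nonneg_left hin hs0
  have h2 : s * (κ * ε * ‖u₀‖) = 2 * D * ε := by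
    calc s * (κ * ε * ‖u₀‖) = s * (κ * ‖u₀‖) * ε := by ring
      _ = 2 * D * ε := by rw [hsκL]
  rw [contactPerturbation_nominal_sq q₀ u₀ (t₀ + s) t₀, hcontact]
  nlinarith [hm2, h1, h2]

/-- Overlap at the end of the window (`0 < D`): if the deviation at time `t₀ + s` is at most `D`, then the
perturbed pair is at distance `< ε` at time `t₀ + s`, `s = 2D/(κ‖u₀‖)`:
`‖q₀ + (t₀ + s) u₀‖² ≤ ε² - 3 D ε < (ε - D)²`. -/
theorem contactPerturbation_overlap {q₀ u₀ q u : E} {ε κ t₀ D : ℝ} (hε : 0 < ε) (hκ : 0 < κ)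
    (hκ1 : κ ≤ 1) (hu₀ : u₀ ≠ 0)
    (hcontact : ‖q₀ + t₀ • u₀‖ = ε) (hin : ⟪q₀ + t₀ • u₀, u₀⟫_ℝ ≤ -(κ * ε * ‖u₀‖))
    (hD : 0 < D) (hDsmall : D < κ ^ 2 * ε / 4)
    (hdev : ‖(q - q₀) + (t₀ + 2 * D / (κ * ‖u₀‖)) • (u - u₀)‖ ≤ D) :
    ‖q + (t₀ + 2 * D / (κ * ‖u₀‖)) • u‖ < ε := by
  have hend := contactPerturbation_nominal_end_sq hκ hu₀ hcontact hin hD.le hDsmall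
  have hκ2 : κ ^ 2 ≤ 1 := pow_le_one₀ hκ.le hκ1
  have hεD : 0 ≤ ε - D := by nlinarith
  have hsq : ‖q₀ + (t₀ + 2 * D / (κ * ‖u₀‖)) • u₀‖ ^ 2 < (ε - D) ^ 2 := by
    nlinarith [mul_pos hD hε]
  have hlt : ‖q₀ + (t₀ + 2 * D / (κ * ‖u₀‖)) • u₀‖ < ε - D := lt_of_pow_lt_pow_left₀ 2 hεD hsq
  linarith [contactPerturbation_le_nominal_add_dev q₀ u₀ q u (t₀ + 2 * D / (κ * ‖u₀‖))]

/-- Non-strict variant of `contactPerturbation_overlap` valid for `0 ≤ D`: distance `≤ ε` at `t₀ + s`. -/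
theorem contactPerturbation_overlap_le {q₀ u₀ q u : E} {ε κ t₀ D : ℝ} (hε : 0 < ε) (hκ : 0 < κ)
    (hκ1 : κ ≤ 1) (hu₀ : u₀ ≠ 0)
    (hcontact : ‖q₀ + t₀ • u₀‖ = ε) (hin : ⟪q₀ + t₀ • u₀, u₀⟫_ℝ ≤ -(κ * ε * ‖u₀‖))
    (hD : 0 ≤ D) (hDsmall : D < κ ^ 2 * ε / 4)
    (hdev : ‖(q - q₀) + (t₀ + 2 * D / (κ * ‖u₀‖)) • (u - u₀)‖ ≤ D) :
    ‖q + (t₀ + 2 * D / (κ * ‖u₀‖)) • u‖ ≤ ε := by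
  have hend := contactPerturbation_nominal_end_sq hκ hu₀ hcontact hin hD hDsmall
  have hκ2 : κ ^ 2 ≤ 1 := pow_le_one₀ hκ.le hκ1
  have hεD : 0 ≤ ε - D := by nlinarith
  have hsq : ‖q₀ + (t₀ + 2 * D / (κ * ‖u₀‖)) • u₀‖ ^ 2 ≤ (ε - D) ^ 2 := by
    nlinarith [mul_nonneg hD hε.le]
  have hle : ‖q₀ + (t₀ + 2 * D / (κ * ‖u₀‖)) • u₀‖ ≤ ε - D := (abs_le_of_sq_le_sq' hsq hεD).2
  linarith [contactPerturbation_le_nominal_add_dev q₀ u₀ q u (t₀ + 2 * D / (κ * ‖u₀‖))]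

/-! ## Contacts in the window: impact vector and incoming sign -/

/-- Backward estimate (real arithmetic). If `x = (t₀ - t)‖u₀‖ ≥ 0` is the nominal backward drift and
`δ ≥ 0` the extra deviation accumulated before time `0`, with `2δ < κ D`, then the contact inequality
`x² + 2κεx ≤ 2ε(D + δ) + (D + δ)²` forces `κ (x + δ) < 2 D`. (At `X = 2D/κ - δ ≤ x` one would get
`X² > (D + δ)²` and `2κεX = 4εD - 2κεδ > 2ε(D + δ)`, a contradiction.) -/
theorem contactPerturbation_backward_aux {κ ε D x δ : ℝ} (hκ : 0 < κ) (hκ1 : κ ≤ 1) (hε : 0 < ε)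
    (hD : 0 < D) (hδ : 0 ≤ δ) (hδs : 2 * δ < κ * D)
    (hc : x ^ 2 + 2 * κ * ε * x ≤ 2 * ε * (D + δ) + (D + δ) ^ 2) :
    κ * (x + δ) < 2 * D := by
  by_contra h
  push Not at h
  set X := 2 * D / κ - δ with hX
  have hκX : κ * X = 2 * D - κ * δ := by rw [hX, mul_sub, mul_div_cancel₀ _ hκ.ne']
  have hXx : X ≤ x := by
    have : κ * X ≤ κ * x := by rw [hκX]; linarith [mul_add κ x δ]
    exact le_of_mul_le_mul_left this hκ
  have h2δ : 2 * δ < D := lt_of_lt_of_le hδs (mul_le_of_le_one_left hD.le hκ1)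
  have hκδ : κ * δ ≤ δ := mul_le_of_le_one_left hδ hκ1
  have hδD : 0 < D - δ * (1 + κ) := by nlinarith
  have hX2D : 2 * D - δ ≤ X := by
    have : 2 * D ≤ 2 * D / κ := by rw [le_div_iff₀ hκ]; nlinarith
    linarith
  have hXpos : D + δ < X := by linarith
  have hDδ : 0 ≤ D + δ := by linarith
  have hX0 : 0 ≤ X := by linarith
  have hsqX : X ^ 2 ≤ x ^ 2 := pow_le_pow_left₀ hX0 hXx 2
  have hDδX : (D + δ) ^ 2 < X ^ 2 := pow_lt_pow_left₀ hXpos hDδ two_ne_zero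
  have hlin : 2 * κ * ε * X ≤ 2 * κ * ε * x := mul_le_mul_of_nonneg_left hXx (by positivity)
  have hκεX : 2 * κ * ε * X = 2 * ε * (2 * D - κ * δ) := by rw [← hκX]; ring
  nlinarith [mul_pos hε hδD]

/-- Impact vector of a contact in the window. If `t ∈ [t₀ - s, t₀ + s]` (`s = 2D/(κ‖u₀‖)`) is a contact time
of the perturbed pair, `‖q + t u‖ = ε`, then `‖(q + t u) - n₀‖ ≤ (1 + 2/κ) D`. For `t ≥ 0` this is
`‖dev(t)‖ + |t - t₀| ‖u₀‖ ≤ D + s‖u₀‖`; for `t < 0` (possible when `t₀ < s`) the deviation is only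
controlled through `dev(t) = dev(0) + t (u - u₀)` and the contact inequality bounds the backward drift
(`contactPerturbation_backward_aux`). -/
theorem contactPerturbation_normal {q₀ u₀ q u : E} {ε κ t₀ D t : ℝ} (hε : 0 < ε) (hκ : 0 < κ)
    (hκ1 : κ ≤ 1) (ht₀ : 0 ≤ t₀) (hu₀ : u₀ ≠ 0)
    (hcontact : ‖q₀ + t₀ • u₀‖ = ε) (hin : ⟪q₀ + t₀ • u₀, u₀⟫_ℝ ≤ -(κ * ε * ‖u₀‖))
    (hD : 0 ≤ D) (hDsmall : D < κ ^ 2 * ε / 4)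
    (hq : ∀ t ∈ Set.Icc 0 (t₀ + 2 * D / (κ * ‖u₀‖)), ‖(q - q₀) + t • (u - u₀)‖ ≤ D)
    (hu : ε * ‖u - u₀‖ ≤ D * ‖u₀‖)
    (ht : t ∈ Set.Icc (t₀ - 2 * D / (κ * ‖u₀‖)) (t₀ + 2 * D / (κ * ‖u₀‖)))
    (hct : ‖q + t • u‖ = ε) :
    ‖(q + t • u) - (q₀ + t₀ • u₀)‖ ≤ (1 + 2 / κ) * D := by
  have hL0 : 0 < ‖u₀‖ := norm_pos_iff.mpr hu₀
  have hκL : 0 < κ * ‖u₀‖ := mul_pos hκ hL0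
  set s := 2 * D / (κ * ‖u₀‖) with hs_def
  have hsκL : s * (κ * ‖u₀‖) = 2 * D := div_mul_cancel₀ _ hκL.ne'
  have hs0 : 0 ≤ s := div_nonneg (by linarith) hκL.le
  have hsL : s * ‖u₀‖ = 2 * D / κ := by
    rw [eq_div_iff hκ.ne', ← hsκL]; ring
  have hgoal : (1 + 2 / κ) * D = D + s * ‖u₀‖ := by rw [hsL]; ring
  -- decomposition of the impact vector
  have hdec := contactPerturbation_sub_nominal_eq q₀ u₀ q u t t₀
  have htri : ‖(q + t • u) - (q₀ + t₀ • u₀)‖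
      ≤ ‖(q - q₀) + t • (u - u₀)‖ + |t - t₀| * ‖u₀‖ := by
    rw [hdec]
    calc ‖(q - q₀) + t • (u - u₀) + (t - t₀) • u₀‖
        ≤ ‖(q - q₀) + t • (u - u₀)‖ + ‖(t - t₀) • u₀‖ := norm_add_le _ _
      _ = ‖(q - q₀) + t • (u - u₀)‖ + |t - t₀| * ‖u₀‖ := by rw [norm_smul, Real.norm_eq_abs]
  have habs : |t - t₀| ≤ s := abs_le.2 ⟨by linarith [ht.1], by linarith [ht.2]⟩
  have hdrift : |t - t₀| * ‖u₀‖ ≤ s * ‖u₀‖ := mul_le_mul_of_nonneg_right habs hL0.le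
  rcases le_or_gt 0 t with h0t | ht0
  · -- forward case: the deviation at `t` is controlled directly
    have hdev : ‖(q - q₀) + t • (u - u₀)‖ ≤ D := hq t ⟨h0t, ht.2⟩
    linarith
  · -- backward case `t < 0` (so `t₀ < s`, in particular `0 < D`)
    have hspos : 0 < s := by linarith [ht.1]
    have hDpos : 0 < D := by
      have := mul_pos hspos hκL
      rw [hsκL] at this
      linarith
    set τ := t₀ - t with hτ_def
    have hτ0 : 0 < τ := by linarith
    have hτs : τ ≤ s := by linarith [ht.1]
    have htτ : |t| ≤ τ := by rw [abs_of_neg ht0]; linarith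
    -- deviation at time `t` through the deviation at time `0`
    have hdev0 : ‖q - q₀‖ ≤ D := by
      have := hq 0 ⟨le_rfl, by linarith⟩
      simpa using this
    set δ := τ * ‖u - u₀‖ with hδ_def
    have hδ0 : 0 ≤ δ := mul_nonneg hτ0.le (norm_nonneg _)
    have hdev : ‖(q - q₀) + t • (u - u₀)‖ ≤ D + δ := by
      calc ‖(q - q₀) + t • (u - u₀)‖ ≤ ‖q - q₀‖ + ‖t • (u - u₀)‖ := norm_add_le _ _
        _ = ‖q - q₀‖ + |t| * ‖u - u₀‖ := by rw [norm_smul, Real.norm_eq_abs]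
        _ ≤ D + τ * ‖u - u₀‖ := add_le_add hdev0 (mul_le_mul_of_nonneg_right htτ (norm_nonneg _))
    -- `2δ < κ D`
    have hδs : 2 * δ < κ * D := by
      have h1 : κ * (ε * δ) ≤ 2 * D * D := by
        calc κ * (ε * δ) = κ * (τ * (ε * ‖u - u₀‖)) := by rw [hδ_def]; ring
          _ ≤ κ * (τ * (D * ‖u₀‖)) :=
            mul_le_mul_of_nonneg_left (mul_le_mul_of_nonneg_left hu hτ0.le) hκ.le
          _ ≤ κ * (s * (D * ‖u₀‖)) :=
            mul_le_mul_of_nonneg_left (mul_le_mul_of_nonneg_right hτs (by positivity)) hκ.le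
          _ = s * (κ * ‖u₀‖) * D := by ring
          _ = 2 * D * D := by rw [hsκL]
      have h2 : 2 * D * D < κ * (ε * (κ * D / 2)) := by nlinarith
      have h3 : ε * δ < ε * (κ * D / 2) := lt_of_mul_lt_mul_left (h1.trans_lt h2) hκ.le
      have h4 : δ < κ * D / 2 := lt_of_mul_lt_mul_left h3 hε.le
      linarith
    -- the contact inequality
    have hnom_le : ‖q₀ + t • u₀‖ ≤ ε + (D + δ) := by
      have := contactPerturbation_nominal_sub_dev_le q₀ u₀ q u t
      rw [hct] at this
      linarith
    have hnom_sq : ‖q₀ + t • u₀‖ ^ 2 ≤ (ε + (D + δ)) ^ 2 :=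
      pow_le_pow_left₀ (norm_nonneg _) hnom_le 2
    have hI : (t - t₀) * -(κ * ε * ‖u₀‖) ≤ (t - t₀) * ⟪q₀ + t₀ • u₀, u₀⟫_ℝ :=
      mul_le_mul_of_nonpos_left hin (by linarith)
    have hc : (τ * ‖u₀‖) ^ 2 + 2 * κ * ε * (τ * ‖u₀‖) ≤ 2 * ε * (D + δ) + (D + δ) ^ 2 := by
      rw [contactPerturbation_nominal_sq q₀ u₀ t t₀, hcontact] at hnom_sq
      have hτt : t - t₀ = -τ := by rw [hτ_def]; ring
      rw [hτt] at hnom_sq hI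
      nlinarith [hnom_sq, hI]
    have hback := contactPerturbation_backward_aux hκ hκ1 hε hDpos hδ0 hδs hc
    -- conclusion
    have hxδ : τ * ‖u₀‖ + δ < s * ‖u₀‖ := by
      rw [hsL, lt_div_iff₀ hκ]; linarith
    have habs' : |t - t₀| * ‖u₀‖ = τ * ‖u₀‖ := by
      rw [show t - t₀ = -τ by rw [hτ_def]; ring, abs_neg, abs_of_pos hτ0]
    linarith

/-- Incoming sign of a contact near the nominal one. If `‖q + t u‖ = ε`, the impact vector is within
`(1 + 2/κ) D` of `n₀`, and `ε ‖u - u₀‖ ≤ D ‖u₀‖`, then `⟪q + t u, u⟫ < 0`: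
`⟪p, u⟫ = ⟪n₀, u₀⟫ + ⟪p - n₀, u₀⟫ + ⟪p, u - u₀⟫ ≤ ‖u₀‖ ((2 + 2/κ) D - κ ε) < 0` as `4 D < κ² ε`, `κ ≤ 1`. -/
theorem contactPerturbation_incoming {q₀ u₀ q u : E} {ε κ t₀ D t : ℝ} (hκ : 0 < κ) (hκ1 : κ ≤ 1)
    (hu₀ : u₀ ≠ 0)
    (hin : ⟪q₀ + t₀ • u₀, u₀⟫_ℝ ≤ -(κ * ε * ‖u₀‖))
    (hD : 0 ≤ D) (hDsmall : D < κ ^ 2 * ε / 4)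
    (hu : ε * ‖u - u₀‖ ≤ D * ‖u₀‖)
    (hct : ‖q + t • u‖ = ε) (hnormal : ‖(q + t • u) - (q₀ + t₀ • u₀)‖ ≤ (1 + 2 / κ) * D) :
    ⟪q + t • u, u⟫_ℝ < 0 := by
  have hL0 : 0 < ‖u₀‖ := norm_pos_iff.mpr hu₀
  have hdecomp : ⟪q + t • u, u⟫_ℝ = ⟪q₀ + t₀ • u₀, u₀⟫_ℝ
      + ⟪(q + t • u) - (q₀ + t₀ • u₀), u₀⟫_ℝ + ⟪q + t • u, u - u₀⟫_ℝ := by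
    rw [inner_sub_left, inner_sub_right]; ring
  have h1 : ⟪(q + t • u) - (q₀ + t₀ • u₀), u₀⟫_ℝ ≤ ‖(q + t • u) - (q₀ + t₀ • u₀)‖ * ‖u₀‖ :=
    real_inner_le_norm _ _
  have h2 : ⟪q + t • u, u - u₀⟫_ℝ ≤ ‖q + t • u‖ * ‖u - u₀‖ := real_inner_le_norm _ _
  rw [hct] at h2
  have hnormal' : κ * ‖(q + t • u) - (q₀ + t₀ • u₀)‖ ≤ (κ + 2) * D := by
    have : κ * ((1 + 2 / κ) * D) = (κ + 2) * D := by field_simp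
    calc κ * ‖(q + t • u) - (q₀ + t₀ • u₀)‖ ≤ κ * ((1 + 2 / κ) * D) :=
          mul_le_mul_of_nonneg_left hnormal hκ.le
      _ = (κ + 2) * D := this
  have h3 := mul_le_mul_of_nonneg_right hnormal' hL0.le
  have hkey : (2 * κ + 2) * D < κ ^ 2 * ε := by nlinarith
  have h4 := mul_lt_mul_of_pos_right hkey hL0
  have hneg : κ * ⟪q + t • u, u⟫_ℝ < 0 := by
    rw [hdecomp]
    nlinarith [mul_le_mul_of_nonneg_left hin hκ.le, mul_le_mul_of_nonneg_left h1 hκ.le,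
      mul_le_mul_of_nonneg_left h2 hκ.le, mul_le_mul_of_nonneg_left hu hκ.le, h3, h4]
  exact neg_of_mul_neg_right hneg hκ.le

/-! ## The registered statement -/

/-- Robust designed contact. Nominal relative data `(q₀, u₀)` of a mover–target pair reach distance
`ε` at time `t₀ ≥ 0` with an incoming normal making an angle of cosine `≥ κ` with `−u₀`
(`⟪n₀, u₀⟫ ≤ −κ ε ‖u₀‖`, `n₀ = q₀ + t₀ u₀`). If the actual data deviate by at most `D` in relative position over
the window and by at most `D‖u₀‖/ε` in relative velocity, with `0 < D < κ² ε / 4`, then, with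
`s = 2D/(κ‖u₀‖)`: no contact strictly before `t₀ − s`; overlap (distance `< ε`) at `t₀ + s`, so that the
(free) pair must have touched in between; and any contact in `[t₀ − s, t₀ + s]` has impact vector within
`(1 + 2/κ) D` of `n₀` and is incoming. (`0 < D` is needed for the strict overlap: for `D = 0` the window is
`{t₀}` and the distance there is exactly `ε`; see `contactPerturbation_nonneg` for the `0 ≤ D` form.) -/
theorem stub_contactPerturbation {E : Type*} [NormedAddCommGroup E] [InnerProductSpace ℝ E]
    {q₀ u₀ q u : E} {ε κ t₀ D : ℝ} (hε : 0 < ε) (hκ : 0 < κ) (hκ1 : κ ≤ 1) (ht₀ : 0 ≤ t₀)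
    (hu₀ : u₀ ≠ 0)
    (hcontact : ‖q₀ + t₀ • u₀‖ = ε) (hin : ⟪q₀ + t₀ • u₀, u₀⟫_ℝ ≤ -(κ * ε * ‖u₀‖))
    (hD : 0 < D) (hDsmall : D < κ ^ 2 * ε / 4)
    (hq : ∀ t ∈ Set.Icc 0 (t₀ + 2 * D / (κ * ‖u₀‖)), ‖(q - q₀) + t • (u - u₀)‖ ≤ D)
    (hu : ε * ‖u - u₀‖ ≤ D * ‖u₀‖) :
    (∀ t ∈ Set.Icc 0 (t₀ + 2 * D / (κ * ‖u₀‖)), t < t₀ - 2 * D / (κ * ‖u₀‖) → ε < ‖q + t • u‖) ∧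
    ‖q + (t₀ + 2 * D / (κ * ‖u₀‖)) • u‖ < ε ∧
    (∀ t ∈ Set.Icc (t₀ - 2 * D / (κ * ‖u₀‖)) (t₀ + 2 * D / (κ * ‖u₀‖)), ‖q + t • u‖ = ε →
        ‖(q + t • u) - (q₀ + t₀ • u₀)‖ ≤ (1 + 2 / κ) * D ∧ ⟪q + t • u, u⟫_ℝ < 0) := by
  have hL0 : 0 < ‖u₀‖ := norm_pos_iff.mpr hu₀
  have hκL : 0 < κ * ‖u₀‖ := mul_pos hκ hL0
  have hs0 : 0 ≤ 2 * D / (κ * ‖u₀‖) := div_nonneg (by linarith) hκL.le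
  refine ⟨fun t ht hlt => ?_, ?_, fun t ht hct => ?_⟩
  · exact contactPerturbation_noEarly hε hκ hκ1 hu₀ hcontact hin hD.le hDsmall (hq t ht) hlt
  · exact contactPerturbation_overlap hε hκ hκ1 hu₀ hcontact hin hD hDsmall
      (hq _ ⟨by linarith, le_rfl⟩)
  · have hn := contactPerturbation_normal hε hκ hκ1 ht₀ hu₀ hcontact hin hD.le hDsmall hq hu ht hct
    exact ⟨hn, contactPerturbation_incoming hκ hκ1 hu₀ hin hD.le hDsmall hu hct hn⟩

/-- The `0 ≤ D` form of the registered statement: identical except that the second conjunct is the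
non-strict `‖q + (t₀ + s) u‖ ≤ ε` (which is all that survives at `D = 0`). -/
theorem contactPerturbation_nonneg {E : Type*} [NormedAddCommGroup E] [InnerProductSpace ℝ E]
    {q₀ u₀ q u : E} {ε κ t₀ D : ℝ} (hε : 0 < ε) (hκ : 0 < κ) (hκ1 : κ ≤ 1) (ht₀ : 0 ≤ t₀)
    (hu₀ : u₀ ≠ 0)
    (hcontact : ‖q₀ + t₀ • u₀‖ = ε) (hin : ⟪q₀ + t₀ • u₀, u₀⟫_ℝ ≤ -(κ * ε * ‖u₀‖))
    (hD : 0 ≤ D) (hDsmall : D < κ ^ 2 * ε / 4)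
    (hq : ∀ t ∈ Set.Icc 0 (t₀ + 2 * D / (κ * ‖u₀‖)), ‖(q - q₀) + t • (u - u₀)‖ ≤ D)
    (hu : ε * ‖u - u₀‖ ≤ D * ‖u₀‖) :
    (∀ t ∈ Set.Icc 0 (t₀ + 2 * D / (κ * ‖u₀‖)), t < t₀ - 2 * D / (κ * ‖u₀‖) → ε < ‖q + t • u‖) ∧
    ‖q + (t₀ + 2 * D / (κ * ‖u₀‖)) • u‖ ≤ ε ∧
    (∀ t ∈ Set.Icc (t₀ - 2 * D / (κ * ‖u₀‖)) (t₀ + 2 * D / (κ * ‖u₀‖)), ‖q + t • u‖ = ε →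
        ‖(q + t • u) - (q₀ + t₀ • u₀)‖ ≤ (1 + 2 / κ) * D ∧ ⟪q + t • u, u⟫_ℝ < 0) := by
  have hL0 : 0 < ‖u₀‖ := norm_pos_iff.mpr hu₀
  have hκL : 0 < κ * ‖u₀‖ := mul_pos hκ hL0
  have hs0 : 0 ≤ 2 * D / (κ * ‖u₀‖) := div_nonneg (by linarith) hκL.le
  refine ⟨fun t ht hlt => ?_, ?_, fun t ht hct => ?_⟩
  · exact contactPerturbation_noEarly hε hκ hκ1 hu₀ hcontact hin hD hDsmall (hq t ht) hlt
  · exact contactPerturbation_overlap_le hε hκ hκ1 hu₀ hcontact hin hD hDsmall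
      (hq _ ⟨by linarith, le_rfl⟩)
  · have hn := contactPerturbation_normal hε hκ hκ1 ht₀ hu₀ hcontact hin hD hDsmall hq hu ht hct
    exact ⟨hn, contactPerturbation_incoming hκ hκ1 hu₀ hin hD hDsmall hu hct hn⟩

end

end Summit.AtomisticToContinuum.HydrodynamicLimit.Theorems.InfluenceLocality.Negative
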